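import Mathlib
import HarnessLib
import Summits.NavierStokesRegularity.NavierStokesRegularity.Theorems.UnthreadedDoorNetFluxHalfLineOUOffNullLemmas
import Summits.NavierStokesRegularity.NavierStokesRegularity.Theorems.UnthreadedDoorNetFluxNullTimeBarrier

/-!
# Route `UnthreadedDoor`, crux `PoloidalLiouville` (stmt-NavierStokesRegularity-1222), WALL W1 — crux idea «null-time», AE-2′:
# half-line OU comparison (viscosity form) with the subsolution inequality known only OFF A CLOSED NULL SET OF TIMES

`halfLineOU_decay_viscosity_offNull` = the landed `Literature.Analysis.FluidPDE.HalfLineOU.halfLineOU_decay_viscosity` with two extra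
hypotheses — `D ⊆ ℝ` closed, `volume D = 0`; `U` Lipschitz in time on every `[a,b] × [0,R]`, `s₁ < a` (the shape of «null-time» AE-3) — and
the viscosity inequality (same cross test class = `NullTime.OUViscosityIneqAt U s₁ C (· ∉ D)`) only at touching points with time `∉ D`.
SAME conclusion.  It replaces the sketch's AE-2 `ViscRemovableNullTimes` (FALSE as typed, ns-wall-crit-1 g3 V19).  Proof = the tree proof
run with the test function `Ψ + G`, `G` the null-time barrier (`NetFlux.exists_nullTimeBarrier`, p686271): `G' = Nψ ≥ 0` keeps `Ψ + G` a
strict supersolution, `0 ≤ G ≤ κ` moves the bound by `κ → 0`, and the slope `N = L + M_d + 1` of `G` just left of `D` forces the interior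
maximiser's time off `D` (`U` is `L`-Lipschitz on `[a′, s̄−δ] × [0,R]`, `a′ > s₁` below every point with `U − Ψ ≥ 0`; `Ψ` decreases in
time at rate `≤ M_d`).  Nothing here proves `stub_scalarLiouville`, `PoloidalLiouville` (1222) or NS regularity (OPEN).
`--supports stmt-NavierStokesRegularity-1222 --as helper`.  [folklore]
-/

noncomputable section

-- the summit and its single sub-problem share the name (CONVENTIONS §1)
set_option linter.dupNamespace false

open Set Function Filter Topology MeasureTheory
open scoped Topology

namespace Summit.NavierStokesRegularity.NavierStokesRegularity.Theorems.PoloidalLiouville.NetFlux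

open Literature.Analysis.FluidPDE Literature.Analysis.FluidPDE.HalfLineOU

set_option maxHeartbeats 800000 in
/-- **Half-line OU decay in the cubic growth class, viscosity form, with the subsolution inequality OFF a closed null set of
times.**  As `HalfLineOU.halfLineOU_decay_viscosity`, plus: `D` closed with `volume D = 0`; `U` Lipschitz in `s` on every
`[a,b] × [0,R]` with `s₁ < a`; the viscosity inequality only at touching points `(s₀,ρ₀)` with `s₀ ∉ D`.  Conclusion unchanged:
`U(s,ρ) ≤ A c (1+ρ)³ e^{−λ(s−s₁)}`.  Proof: the tree proof with the test function `Ψ + G`, `G` the null-time barrier. [folklore] -/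
theorem halfLineOU_decay_viscosity_offNull : ∀ C : ℝ, 0 ≤ C → ∃ lam > 0, ∃ A : ℝ,
    ∀ (U : ℝ → ℝ → ℝ) (s₁ c : ℝ) (D : Set ℝ), IsClosed D → volume D = 0 →
    ContinuousOn (uncurry U) (Ici s₁ ×ˢ Ici 0) →
    (∀ s, s₁ ≤ s → U s 0 ≤ 0) →
    (∀ s, s₁ ≤ s → ∀ ρ, 0 ≤ ρ → U s ρ ≤ c * (1 + ρ) ^ 3) →
    0 ≤ c →
    (∀ a b R : ℝ, s₁ < a → a < b → 0 < R →
      ∃ L : NNReal, ∀ ρ ∈ Icc 0 R, LipschitzOnWith L (fun s => U s ρ) (Icc a b)) →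
    (∀ (φ : ℝ → ℝ → ℝ) (φₛ : ℝ) (φ₁ φ₂ : ℝ → ℝ) (s₀ ρ₀ : ℝ), s₁ < s₀ → 0 < ρ₀ → s₀ ∉ D →
      HasDerivAt (fun σ => φ σ ρ₀) φₛ s₀ →
      (∀ r, HasDerivAt (φ s₀) (φ₁ r) r) → (∀ r, HasDerivAt φ₁ (φ₂ r) r) →
      IsLocalMax (fun p : ℝ × ℝ => U p.1 p.2 - φ p.1 p.2) (s₀, ρ₀) →
      φₛ ≤ φ₂ ρ₀ + (C - ρ₀ / 2) * φ₁ ρ₀) →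
    ∀ s, s₁ ≤ s → ∀ ρ, 0 ≤ ρ → U s ρ ≤ A * c * (1 + ρ) ^ 3 * Real.exp (-lam * (s - s₁)) := by
  intro C hC
  obtain ⟨K, K', K'', lam, A₀, A₁, hlam, hA₀0, hA₁0, hK1, hK2, hKin, hKone, hlow, hup⟩ :=
    exists_cubic_barrier_bounds hC
  refine ⟨lam, hlam, A₀ * A₁, ?_⟩
  intro U s₁ c D hD hD0 hcont h0 hbd hc0 hLip hvisc s hs ρ hρ
  set ν : ℝ := 12 + 4 * C with hν
  have hν0 : 0 ≤ ν := by rw [hν]; linarith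
  set Φ : ℝ → ℝ → ℝ := fun σ r => A₀ * c * Real.exp (-lam * (σ - s₁)) * K r with hΦ
  set Z : ℝ → ℝ → ℝ := fun σ r => Real.exp (ν * (σ - s₁)) * (1 + r ^ 4) with hZ
  have hΦnn : ∀ σ r, 0 ≤ r → 0 ≤ Φ σ r := fun σ r hr => by
    rw [hΦ]; have := hKone r hr; positivity
  have hZnn : ∀ σ r, 0 ≤ Z σ r := fun σ r => by rw [hZ]; positivity
  have hΦt : ∀ σ r, HasDerivAt (fun τ => Φ τ r) ((-lam) * Φ σ r) σ := fun σ r =>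
    hasDerivAt_expDecay_mul (A₀ * c) lam s₁ (K r) σ
  have hZt : ∀ σ r, HasDerivAt (fun τ => Z τ r) (ν * Z σ r) σ := fun σ r =>
    hasDerivAt_expGrowth_mul ν s₁ (1 + r ^ 4) σ
  have hΦr : ∀ σ r, HasDerivAt (Φ σ) (A₀ * c * Real.exp (-lam * (σ - s₁)) * K' r) r :=
    fun σ r => (hK1 r).const_mul _
  have hΦrr : ∀ σ r, HasDerivAt (fun r => A₀ * c * Real.exp (-lam * (σ - s₁)) * K' r)
      (A₀ * c * Real.exp (-lam * (σ - s₁)) * K'' r) r := fun σ r => (hK2 r).const_mul _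
  have hZr : ∀ σ r, HasDerivAt (Z σ) (Real.exp (ν * (σ - s₁)) * (4 * r ^ 3)) r := fun σ r =>
    hasDerivAt_one_add_pow_four _ r
  have hZrr : ∀ σ r, HasDerivAt (fun r => Real.exp (ν * (σ - s₁)) * (4 * r ^ 3))
      (Real.exp (ν * (σ - s₁)) * (12 * r ^ 2)) r := fun σ r => hasDerivAt_four_mul_pow_three _ r
  have hKc : Continuous K := continuous_iff_continuousAt.2 fun r => (hK1 r).continuousAt
  have hΦc : Continuous (uncurry Φ) := by
    rw [hΦ]
    show Continuous fun p : ℝ × ℝ => A₀ * c * Real.exp (-lam * (p.1 - s₁)) * K p.2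
    fun_prop
  have hZc : Continuous (uncurry Z) := by
    rw [hZ]
    show Continuous fun p : ℝ × ℝ => Real.exp (ν * (p.1 - s₁)) * (1 + p.2 ^ 4)
    fun_prop
  have hZineq : ∀ x : ℝ, 0 < x → 12 * x ^ 2 + (C - x / 2) * (4 * x ^ 3) ≤ ν * (1 + x ^ 4) := by
    intro x hx0; rw [hν]; exact quartic_farField_ineq hC x hx0
  -- MAIN CLAIM: `U s ρ ≤ Φ s ρ + c η Z s ρ + θ + κ` for every `η, θ, κ > 0`
  have key : ∀ η θ κ : ℝ, 0 < η → 0 < θ → 0 < κ → U s ρ ≤ Φ s ρ + c * η * Z s ρ + θ + κ := by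
    intro η θ κ hη hθ hκ
    set R : ℝ := ρ + 1 + 8 / η with hR
    have hR1 : 1 ≤ R := by rw [hR]; have := div_pos (by norm_num : (0:ℝ) < 8) hη; linarith
    have hρR : ρ < R := by rw [hR]; have := div_pos (by norm_num : (0:ℝ) < 8) hη; linarith
    have hRη : (1 + R) ^ 3 ≤ η * (1 + R ^ 4) := by
      have h1 : (1 + R) ^ 3 ≤ (2 * R) ^ 3 := pow_le_pow_left₀ (by linarith) (by linarith) 3
      have h1' : (2 * R) ^ 3 = 8 * R ^ 3 := by ring
      have h2 : 8 / η ≤ R := by rw [hR]; linarith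
      have h3 : 8 ≤ η * R := by
        have := mul_le_mul_of_nonneg_left h2 hη.le
        rwa [mul_div_cancel₀ _ hη.ne'] at this
      have hR3 : 0 ≤ R ^ 3 := by positivity
      have h4 : 8 * R ^ 3 ≤ η * R * R ^ 3 := mul_le_mul_of_nonneg_right h3 hR3
      have h5 : η * R * R ^ 3 = η * R ^ 4 := by ring
      have h6 : η * R ^ 4 ≤ η * (1 + R ^ 4) := by nlinarith [hη.le]
      linarith
    set sbar : ℝ := s + 1 with hsbar
    set M : ℝ := c * (1 + R) ^ 3 + 1 with hM
    have hM0 : 0 < M := by rw [hM]; positivity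
    set δ : ℝ := min 1 (θ / M) / 2 with hδ
    have hδ0 : 0 < δ := by rw [hδ]; have := div_pos hθ hM0; positivity
    have hδ1 : δ ≤ 1 / 2 := by rw [hδ]; have := min_le_left (1 : ℝ) (θ / M); linarith
    have hδθ : δ < θ / M := by
      rw [hδ]; have := min_le_right (1 : ℝ) (θ / M); have := div_pos hθ hM0; linarith
    set Ψ : ℝ → ℝ → ℝ := fun σ r => Φ σ r + c * η * Z σ r + θ * (sbar - σ)⁻¹ with hΨ
    set g : ℝ → ℝ → ℝ := fun σ r => U σ r - Ψ σ r with hg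
    set B : Set (ℝ × ℝ) := Icc s₁ (sbar - δ) ×ˢ Icc 0 R with hB
    have hsB : s ≤ sbar - δ := by rw [hsbar]; linarith
    have hBc : IsCompact B := isCompact_Icc.prod isCompact_Icc
    have hBne : B.Nonempty := ⟨(s, ρ), ⟨hs, hsB⟩, ⟨hρ, hρR.le⟩⟩
    have hpen : ContinuousOn (fun p : ℝ × ℝ => θ * (sbar - p.1)⁻¹) B := by
      refine continuousOn_const.mul (ContinuousOn.inv₀ (by fun_prop) fun p hp => ?_)
      have : p.1 ≤ sbar - δ := hp.1.2
      linarith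
    have hgc : ContinuousOn (uncurry g) B := by
      have hU : ContinuousOn (uncurry U) B := hcont.mono (prod_mono Icc_subset_Ici_self Icc_subset_Ici_self)
      have h1 : ContinuousOn (fun p : ℝ × ℝ => uncurry U p -
          (uncurry Φ p + c * η * uncurry Z p + θ * (sbar - p.1)⁻¹)) B :=
        hU.sub ((hΦc.continuousOn.add ((hZc.continuousOn).const_smul (c * η) |>.congr
          (fun p _ => by simp [smul_eq_mul]))).add hpen)
      exact h1.congr fun p _ => by rcases p with ⟨σ, r⟩; rfl
    have hθs : θ * (sbar - s)⁻¹ = θ := by rw [hsbar]; simp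
    have hgs : g s ρ = U s ρ - (Φ s ρ + c * η * Z s ρ + θ * (sbar - s)⁻¹) := rfl
    have hbot : ∀ r ∈ Icc 0 R, g s₁ r < 0 := by
      intro r hr
      have h1 := hbd s₁ le_rfl r hr.1
      have h2 : c * (1 + r) ^ 3 ≤ Φ s₁ r := by
        show c * (1 + r) ^ 3 ≤ A₀ * c * Real.exp (-lam * (s₁ - s₁)) * K r
        rw [sub_self, mul_zero, Real.exp_zero, mul_one]
        nlinarith [mul_le_mul_of_nonneg_left (hlow r hr.1) hc0]
      have h3 : 0 < θ * (sbar - s₁)⁻¹ := mul_pos hθ (inv_pos.2 (by linarith [hs, hsB, hδ0]))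
      have h4 : 0 ≤ c * η * Z s₁ r := by have := hZnn s₁ r; positivity
      have h5 : g s₁ r = U s₁ r - (Φ s₁ r + c * η * Z s₁ r + θ * (sbar - s₁)⁻¹) := rfl
      linarith only [h1, h2, h3, h4, h5]
    -- the set where `g ≥ 0` is compact and stays away from `σ = s₁`
    set S : Set (ℝ × ℝ) := B ∩ (uncurry g) ⁻¹' (Ici 0) with hS
    have hBcl : IsClosed B := isClosed_Icc.prod isClosed_Icc
    have hSc : IsCompact S := hBc.of_isClosed_subset (hgc.preimage_isClosed_of_isClosed hBcl isClosed_Ici)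
      inter_subset_left
    by_cases hSne : ¬ S.Nonempty
    · -- `g < 0` on all of `B`, in particular at `(s, ρ)`
      have hsS : (s, ρ) ∉ S := fun h => hSne ⟨_, h⟩
      have hgs0 : g s ρ < 0 := by
        by_contra h
        exact hsS ⟨⟨⟨hs, hsB⟩, ⟨hρ, hρR.le⟩⟩, not_lt.1 h⟩
      rw [hθs] at hgs
      linarith only [hgs0, hgs, hκ.le]
    rw [not_not] at hSne
    obtain ⟨pm, hpmS, hpmin⟩ := hSc.exists_isMinOn hSne continuous_fst.continuousOn
    have hpmB : pm ∈ B := hpmS.1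
    have hpmg : 0 ≤ uncurry g pm := hpmS.2
    have hpm1 : s₁ < pm.1 := by
      rcases eq_or_lt_of_le hpmB.1.1 with h | h
      · exfalso
        have := hbot pm.2 hpmB.2
        rw [h] at this
        exact absurd hpmg (not_le.2 this)
      · exact h
    set a' : ℝ := (s₁ + pm.1) / 2 with ha'
    have ha'1 : s₁ < a' := by rw [ha']; linarith
    have ha'2 : a' < pm.1 := by rw [ha']; linarith
    have ha'S : ∀ p ∈ B, 0 ≤ uncurry g p → a' < p.1 := fun p hpB hgp =>
      ha'2.trans_le (hpmin ⟨hpB, hgp⟩)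
    have ha'b : a' < sbar - δ := ha'2.trans_le hpmB.1.2
    have hR0 : 0 < R := by linarith
    obtain ⟨L, hL⟩ := hLip a' (sbar - δ) R ha'1 ha'b hR0
    set Md : ℝ := lam * (A₀ * c * (A₁ * (1 + R) ^ 3)) + 1 with hMdef
    have hMd0 : 0 < Md := by rw [hMdef]; positivity
    have hΨdec : ∀ σ' σ r, s₁ ≤ σ' → σ' ≤ σ → σ < sbar → r ∈ Icc 0 R →
        Ψ σ' r - Ψ σ r ≤ Md * (σ - σ') := by
      intro σ' σ r hσ' hσ'σ hσb hr
      have hK0 : 0 ≤ K r := (zero_le_one.trans (hKone r hr.1))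
      have hKR : K r ≤ A₁ * (1 + R) ^ 3 := by
        refine (hup r hr.1).trans (mul_le_mul_of_nonneg_left ?_ hA₁0.le)
        exact pow_le_pow_left₀ (by linarith [hr.1]) (by linarith [hr.2]) 3
      have hexp := exp_decay_sub_le (σ := σ) hlam hσ' hσ'σ
      have hΦd : Φ σ' r - Φ σ r ≤ lam * (A₀ * c * (A₁ * (1 + R) ^ 3)) * (σ - σ') := by
        have e1 : Φ σ' r - Φ σ r = A₀ * c * K r * (Real.exp (-lam * (σ' - s₁)) - Real.exp (-lam * (σ - s₁))) := by
          simp only [hΦ]; ring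
        rw [e1]
        have hc1 : 0 ≤ A₀ * c * K r := by positivity
        have h7 : 0 ≤ lam * (σ - σ') := mul_nonneg hlam.le (by linarith)
        have h8 : A₀ * c * K r ≤ A₀ * c * (A₁ * (1 + R) ^ 3) := mul_le_mul_of_nonneg_left hKR (by positivity)
        calc A₀ * c * K r * (Real.exp (-lam * (σ' - s₁)) - Real.exp (-lam * (σ - s₁)))
            ≤ A₀ * c * K r * (lam * (σ - σ')) := mul_le_mul_of_nonneg_left hexp hc1
          _ ≤ A₀ * c * (A₁ * (1 + R) ^ 3) * (lam * (σ - σ')) := mul_le_mul_of_nonneg_right h8 h7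
          _ = lam * (A₀ * c * (A₁ * (1 + R) ^ 3)) * (σ - σ') := by ring
      have hZd : c * η * Z σ' r - c * η * Z σ r ≤ 0 := by
        have h1 : Z σ' r ≤ Z σ r := by
          simp only [hZ]
          refine mul_le_mul_of_nonneg_right (Real.exp_le_exp.2 ?_) (by positivity)
          exact mul_le_mul_of_nonneg_left (by linarith) hν0
        have h2 := mul_le_mul_of_nonneg_left h1 (mul_nonneg hc0 hη.le)
        linarith
      have hPd : θ * (sbar - σ')⁻¹ - θ * (sbar - σ)⁻¹ ≤ 0 := by
        have h1 : (sbar - σ')⁻¹ ≤ (sbar - σ)⁻¹ := by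
          apply inv_anti₀ (by linarith) (by linarith)
        have h2 := mul_le_mul_of_nonneg_left h1 hθ.le
        linarith
      have e2 : Ψ σ' r - Ψ σ r = (Φ σ' r - Φ σ r) + (c * η * Z σ' r - c * η * Z σ r)
          + (θ * (sbar - σ')⁻¹ - θ * (sbar - σ)⁻¹) := by simp only [hΨ]; ring
      have e3 : Md * (σ - σ') = lam * (A₀ * c * (A₁ * (1 + R) ^ 3)) * (σ - σ') + (σ - σ') := by
        rw [hMdef]; ring
      have h9 : 0 ≤ σ - σ' := by linarith
      rw [e2, e3]
      linarith
    -- the null-time barrier with slope `N = L + Md + 1` left of `D` and size `≤ κ`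
    set N : ℝ := (L : ℝ) + Md + 1 with hNdef
    have hN0 : 0 < N := by rw [hNdef]; positivity
    obtain ⟨G, ψ, hψc, hψ0, hGd, hGmono, hG0, hGκ, hGD⟩ := exists_nullTimeBarrier hD hD0 s₁ hN0 hκ
    have hGc : Continuous G := continuous_iff_continuousAt.2 fun σ => (hGd σ).continuousAt
    set gG : ℝ → ℝ → ℝ := fun σ r => g σ r - G σ with hgG
    have hgGc : ContinuousOn (uncurry gG) B :=
      (hgc.sub (hGc.comp_continuousOn continuous_fst.continuousOn)).congr fun p _ => by rcases p with ⟨σ, r⟩; rfl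
    obtain ⟨p₀, hp₀B, hmax⟩ := hBc.exists_isMaxOn hBne hgGc
    suffices hmax0 : uncurry gG p₀ ≤ 0 by
      have h1 : uncurry gG (s, ρ) ≤ uncurry gG p₀ := hmax ⟨⟨hs, hsB⟩, ⟨hρ, hρR.le⟩⟩
      have h2 : gG s ρ ≤ 0 := h1.trans hmax0
      have h4 : gG s ρ = g s ρ - G s := rfl
      have h5 := hGκ s
      rw [hθs] at hgs
      linarith only [h2, h4, h5, hgs]
    by_contra hpos
    push Not at hpos
    obtain ⟨σ₀, r₀⟩ := p₀
    have hσ₀ : σ₀ ∈ Icc s₁ (sbar - δ) := hp₀B.1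
    have hr₀ : r₀ ∈ Icc 0 R := hp₀B.2
    have hgval : g σ₀ r₀ = U σ₀ r₀ - (Φ σ₀ r₀ + c * η * Z σ₀ r₀ + θ * (sbar - σ₀)⁻¹) := rfl
    have hposG : 0 < g σ₀ r₀ - G σ₀ := hpos
    have hpos' : 0 < g σ₀ r₀ := by linarith only [hposG, hG0 σ₀ hσ₀.1]
    have hden0 : 0 < sbar - σ₀ := by linarith [hσ₀.2]
    have hpen0 : 0 < θ * (sbar - σ₀)⁻¹ := mul_pos hθ (inv_pos.2 hden0)
    have hΦ0 := hΦnn σ₀ r₀ hr₀.1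
    have hZ0 : 0 ≤ c * η * Z σ₀ r₀ := by have := hZnn σ₀ r₀; positivity
    have hσ₀gt : s₁ < σ₀ := by
      rcases eq_or_lt_of_le hσ₀.1 with h | h
      · exfalso
        have h1 := hbd s₁ le_rfl r₀ hr₀.1
        have h2 : c * (1 + r₀) ^ 3 ≤ Φ s₁ r₀ := by
          show c * (1 + r₀) ^ 3 ≤ A₀ * c * Real.exp (-lam * (s₁ - s₁)) * K r₀
          rw [sub_self, mul_zero, Real.exp_zero, mul_one]
          nlinarith [mul_le_mul_of_nonneg_left (hlow r₀ hr₀.1) hc0]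
        rw [← h] at hgval hpos' hpen0 hZ0
        linarith only [hgval, hpos', hpen0, hZ0, h1, h2]
      · exact h
    have hσ₀lt : σ₀ < sbar - δ := by
      rcases eq_or_lt_of_le hσ₀.2 with h | h
      · exfalso
        have h1 := hbd σ₀ hσ₀.1 r₀ hr₀.1
        have h2 : c * (1 + r₀) ^ 3 ≤ c * (1 + R) ^ 3 := by
          have : (1 + r₀) ^ 3 ≤ (1 + R) ^ 3 := pow_le_pow_left₀ (by linarith [hr₀.1]) (by linarith [hr₀.2]) 3
          exact mul_le_mul_of_nonneg_left this hc0
        have h3 : M ≤ θ * (sbar - σ₀)⁻¹ := by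
          rw [h, sub_sub_cancel, ← div_eq_mul_inv, le_div_iff₀ hδ0]
          have := (lt_div_iff₀ hM0).1 hδθ
          linarith only [this]
        rw [hM] at h3
        linarith only [hgval, hpos', h1, h2, h3, hΦ0, hZ0]
      · exact h
    -- (iii) not on the lateral boundary `r₀ = 0` or `r₀ = R`
    have hr₀gt : 0 < r₀ := by
      rcases eq_or_lt_of_le hr₀.1 with h | h
      · exfalso
        rw [← h] at hgval hpos' hΦ0 hZ0
        have h1 := h0 σ₀ hσ₀.1
        linarith only [hgval, hpos', hΦ0, hZ0, h1, hpen0]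
      · exact h
    have hr₀lt : r₀ < R := by
      rcases eq_or_lt_of_le hr₀.2 with h | h
      · exfalso
        rw [h] at hgval hpos' hΦ0 hZ0
        have h1 := hbd σ₀ hσ₀.1 R (by linarith)
        have h2 : c * (1 + R) ^ 3 ≤ c * η * Z σ₀ R := by
          show c * (1 + R) ^ 3 ≤ c * η * (Real.exp (ν * (σ₀ - s₁)) * (1 + R ^ 4))
          have he : 1 ≤ Real.exp (ν * (σ₀ - s₁)) := by
            apply Real.one_le_exp; exact mul_nonneg hν0 (by linarith [hσ₀.1])
          have h3 : η * (1 + R ^ 4) ≤ η * (Real.exp (ν * (σ₀ - s₁)) * (1 + R ^ 4)) := by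
            have : (1 + R ^ 4) ≤ Real.exp (ν * (σ₀ - s₁)) * (1 + R ^ 4) :=
              le_mul_of_one_le_left (by positivity) he
            exact mul_le_mul_of_nonneg_left this hη.le
          calc c * (1 + R) ^ 3 ≤ c * (η * (Real.exp (ν * (σ₀ - s₁)) * (1 + R ^ 4))) :=
                mul_le_mul_of_nonneg_left (hRη.trans h3) hc0
            _ = c * η * (Real.exp (ν * (σ₀ - s₁)) * (1 + R ^ 4)) := by ring
        linarith only [hgval, hpos', hΦ0, h1, h2, hpen0]
      · exact h
    -- (iv) interior point: a local maximum of `U − Ψ` in `ℝ × ℝ`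
    have hBnhds : B ∈ 𝓝 (σ₀, r₀) := by
      rw [hB]
      exact prod_mem_nhds (Icc_mem_nhds hσ₀gt hσ₀lt) (Icc_mem_nhds hr₀gt hr₀lt)
    have hloc : IsLocalMax (fun p : ℝ × ℝ => U p.1 p.2 - (Ψ p.1 p.2 + G p.1)) (σ₀, r₀) := by
      have h1 : IsMaxOn (uncurry gG) B (σ₀, r₀) := hmax
      have h2 : IsLocalMax (uncurry gG) (σ₀, r₀) := h1.isLocalMax hBnhds
      have h3 : (uncurry gG) = fun p : ℝ × ℝ => U p.1 p.2 - (Ψ p.1 p.2 + G p.1) := by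
        funext p
        rcases p with ⟨σ, r⟩
        show g σ r - G σ = U σ r - (Ψ σ r + G σ)
        simp only [hg]; ring
      rw [h3] at h2
      exact h2
    -- (v) the touching time is NOT in `D`: there `G` has left slope `N > L + Md`
    have hσ₀D : σ₀ ∉ D := by
      intro hmem
      obtain ⟨r, hr, hslope⟩ := hGD σ₀ hmem
      have ha'σ₀ : a' < σ₀ := ha'S (σ₀, r₀) hp₀B hpos'.le
      set σ : ℝ := max (σ₀ - r) a' with hσdef
      have hσlt : σ < σ₀ := max_lt (by linarith) ha'σ₀
      have hσa' : a' ≤ σ := le_max_right _ _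
      have hσr : σ ∈ Icc (σ₀ - r) σ₀ := ⟨le_max_left _ _, hσlt.le⟩
      have hσB : (σ, r₀) ∈ B := ⟨⟨ha'1.le.trans hσa', hσlt.le.trans hσ₀.2⟩, hr₀⟩
      have hGs : G σ₀ - G σ = N * (σ₀ - σ) := hslope σ hσr
      -- maximality of `(σ₀, r₀)`
      have hm : uncurry gG (σ, r₀) ≤ uncurry gG (σ₀, r₀) := hmax hσB
      have hm' : (U σ r₀ - Ψ σ r₀) - G σ ≤ (U σ₀ r₀ - Ψ σ₀ r₀) - G σ₀ := hm
      -- Lipschitz bound on `U` and decrease bound on `Ψ`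
      have hLip' := (hL r₀ hr₀).dist_le_mul σ₀ ⟨ha'σ₀.le, hσ₀.2⟩ σ ⟨hσa', hσlt.le.trans hσ₀.2⟩
      rw [Real.dist_eq, Real.dist_eq, abs_of_pos (sub_pos.2 hσlt)] at hLip'
      have hU : U σ₀ r₀ - U σ r₀ ≤ L * (σ₀ - σ) := (le_abs_self _).trans hLip'
      have hΨ' : Ψ σ r₀ - Ψ σ₀ r₀ ≤ Md * (σ₀ - σ) :=
        hΨdec σ σ₀ r₀ (ha'1.le.trans hσa') hσlt.le (by linarith [hσ₀.2]) hr₀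
      have hNs : N * (σ₀ - σ) = (L : ℝ) * (σ₀ - σ) + Md * (σ₀ - σ) + (σ₀ - σ) := by rw [hNdef]; ring
      have hpos2 : 0 < σ₀ - σ := sub_pos.2 hσlt
      linarith
    -- the test function data of `Ψ` at `(σ₀, r₀)`
    have hpent : HasDerivAt (fun σ => θ * (sbar - σ)⁻¹) (θ * ((sbar - σ₀) ^ 2)⁻¹) σ₀ := by
      have h1 : HasDerivAt (fun σ => sbar - σ) (-1) σ₀ := by
        simpa using (hasDerivAt_id σ₀).const_sub sbar
      have h2 := h1.inv hden0.ne'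
      have h3 := h2.const_mul θ
      refine h3.congr_deriv ?_
      rw [neg_neg, one_div]
    set Ψs : ℝ := (-lam) * Φ σ₀ r₀ + c * η * (ν * Z σ₀ r₀) + θ * ((sbar - σ₀) ^ 2)⁻¹ with hΨs
    have hΨt : HasDerivAt (fun σ => Ψ σ r₀ + G σ) (Ψs + N * ψ σ₀) σ₀ :=
      (((hΦt σ₀ r₀).add ((hZt σ₀ r₀).const_mul (c * η))).add hpent).add (hGd σ₀)
    set Ψ₁ : ℝ → ℝ := fun r => A₀ * c * Real.exp (-lam * (σ₀ - s₁)) * K' r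
      + c * η * (Real.exp (ν * (σ₀ - s₁)) * (4 * r ^ 3)) with hΨ₁
    set Ψ₂ : ℝ → ℝ := fun r => A₀ * c * Real.exp (-lam * (σ₀ - s₁)) * K'' r
      + c * η * (Real.exp (ν * (σ₀ - s₁)) * (12 * r ^ 2)) with hΨ₂
    have hΨr : ∀ r, HasDerivAt (fun r => Ψ σ₀ r + G σ₀) (Ψ₁ r) r := by
      intro r
      exact (((hΦr σ₀ r).add ((hZr σ₀ r).const_mul (c * η))).add_const (θ * (sbar - σ₀)⁻¹)).add_const (G σ₀)
    have hΨrr : ∀ r, HasDerivAt Ψ₁ (Ψ₂ r) r := fun r =>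
      (hΦrr σ₀ r).add ((hZrr σ₀ r).const_mul (c * η))
    -- the viscosity inequality at the touching point
    have hV0 := hvisc (fun σ r => Ψ σ r + G σ) (Ψs + N * ψ σ₀) Ψ₁ Ψ₂ σ₀ r₀ hσ₀gt hr₀gt hσ₀D hΨt hΨr hΨrr hloc
    have hNψ : 0 ≤ N * ψ σ₀ := mul_nonneg hN0.le (hψ0 σ₀)
    have hV : Ψs ≤ Ψ₂ r₀ + (C - r₀ / 2) * Ψ₁ r₀ := by linarith only [hV0, hNψ]
    -- … contradicts strict supersolution: barrier inequalities
    have hKx := hKin r₀ hr₀gt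
    have hexp0 : 0 ≤ A₀ * c * Real.exp (-lam * (σ₀ - s₁)) := by positivity
    have hexpZ : 0 ≤ c * η * Real.exp (ν * (σ₀ - s₁)) := by positivity
    have hpen2 : 0 < θ * ((sbar - σ₀) ^ 2)⁻¹ := mul_pos hθ (inv_pos.2 (pow_pos hden0 2))
    have hV' : (-lam) * (A₀ * c * Real.exp (-lam * (σ₀ - s₁)) * K r₀)
        + c * η * (ν * (Real.exp (ν * (σ₀ - s₁)) * (1 + r₀ ^ 4))) + θ * ((sbar - σ₀) ^ 2)⁻¹
        ≤ (A₀ * c * Real.exp (-lam * (σ₀ - s₁)) * K'' r₀ + c * η * (Real.exp (ν * (σ₀ - s₁)) * (12 * r₀ ^ 2)))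
          + (C - r₀ / 2) * (A₀ * c * Real.exp (-lam * (σ₀ - s₁)) * K' r₀
            + c * η * (Real.exp (ν * (σ₀ - s₁)) * (4 * r₀ ^ 3))) := hV
    generalize hEx : A₀ * c * Real.exp (-lam * (σ₀ - s₁)) = Ex at hV' hexp0
    generalize hEz : Real.exp (ν * (σ₀ - s₁)) = Ez at hV' hexpZ
    generalize hP : θ * ((sbar - σ₀) ^ 2)⁻¹ = P at hV' hpen2
    have hbar : Ex * (K'' r₀ + (C - r₀ / 2) * K' r₀ + lam * K r₀) ≤ Ex * 0 :=
      mul_le_mul_of_nonneg_left hKx hexp0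
    have hZf : c * η * Ez * (12 * r₀ ^ 2 + (C - r₀ / 2) * (4 * r₀ ^ 3)) ≤ c * η * Ez * (ν * (1 + r₀ ^ 4)) :=
      mul_le_mul_of_nonneg_left (hZineq r₀ hr₀gt) hexpZ
    linarith only [hV', hbar, hZf, hpen2]
  -- let `θ, η → 0`
  have hlim : U s ρ ≤ Φ s ρ := by
    apply le_of_forall_pos_le_add
    intro e he
    have hZ0 := hZnn s ρ
    set η : ℝ := (e / 2) / (c * Z s ρ + 1) with hη
    have hden : 0 < c * Z s ρ + 1 := by positivity
    have hη0 : 0 < η := div_pos (by linarith) hden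
    have h1 := key η (e / 4) (e / 4) hη0 (by linarith) (by linarith)
    have h2 : c * η * Z s ρ ≤ e / 2 := by
      have : c * η * Z s ρ = (e / 2) * (c * Z s ρ / (c * Z s ρ + 1)) := by rw [hη]; field_simp
      rw [this]
      have : c * Z s ρ / (c * Z s ρ + 1) ≤ 1 := by
        rw [div_le_one hden]; linarith
      nlinarith
    linarith
  -- `Φ s ρ ≤ A₀ A₁ c (1+ρ)³ e^{−λ(s−s₁)}`
  calc U s ρ ≤ Φ s ρ := hlim
    _ = A₀ * c * Real.exp (-lam * (s - s₁)) * K ρ := rfl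
    _ ≤ A₀ * c * Real.exp (-lam * (s - s₁)) * (A₁ * (1 + ρ) ^ 3) :=
        mul_le_mul_of_nonneg_left (hup ρ hρ) (by positivity)
    _ = A₀ * A₁ * c * (1 + ρ) ^ 3 * Real.exp (-lam * (s - s₁)) := by ring

end Summit.NavierStokesRegularity.NavierStokesRegularity.Theorems.PoloidalLiouville.NetFlux
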